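import Literature.Geometry.Symplectic.JPlanePencilLocalFamilyProofs
import Literature.Geometry.Symplectic.JHolomorphicIntersectionDichotomy
import Literature.Geometry.Symplectic.JSphereMeetsEmbeddedJSphere
import HarnessLib

/-!
# Unique continuation for pencil members: two members meeting on an accumulating set coincide

Support theorems (no named facts, D-0026) for
`Literature.Geometry.Symplectic.jPlanePencil_localFamily_homotopySphere`
(`JPlanePencilLocalFamily.lean`; C. Wendl, *Holomorphic Curves in Low Dimensions* (2018),
Prop. 2.53 with `m = 1`, for homotopy 4-spheres).

Wendl, proof of Prop. 2.53 with Thm. 2.49: two curves of the constrained family "are either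
identical or [meet only at the constraint point]". The IDENTICAL half is unique continuation:
in the tree's plane form, if a member `u` meets the image of a member `L` along parameters
accumulating at some `ξ*`, then `u = L` (`IsPencilPlane.eq_of_frequently_mem_range`). The proof
follows McDuff 1991, Lemma 2.7, through the tree's PROVED dichotomy
`jHolomorphic_intersectionDichotomy_holds` (two `J`-curves through a common point, one immersed
there: isolated pair of parameters, or nested image germs): the set of parameters near which `u`
stays in `L(ℂ)` is open, closed (members are closed embeddings, so `L⁻¹` is continuous on the
closed set `L(ℂ)` and accumulating intersections defeat the isolated alternative) and nonempty,
hence all of `ℂ`; then `L⁻¹(u(ℂ))` is clopen in `ℂ` by the reverse nesting, so the images agree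
and `IsPencilPlane.eq_of_range_eq` (rigidity of the canonical parametrisation) concludes.

## References

* C. Wendl, *Holomorphic Curves in Low Dimensions*, LNM 2216, Springer (2018), Prop. 2.53,
  Thm. 2.49. [Wendl2018]
* D. McDuff, *The local behaviour of holomorphic curves in almost complex 4-manifolds*,
  J. Differential Geom. 34 (1991), Lemma 2.7. [McDuff1991LocalBehaviour]
-/

noncomputable section

open scoped Manifold ContDiff Topology
open Set Function Filter Metric

namespace Literature.Geometry.Symplectic

namespace IsPencilPlane

variable {M : Type} [TopologicalSpace M] [T2Space M] [SecondCountableTopology M]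
  [ChartedSpace (EuclideanSpace ℝ (Fin 4)) M] [IsManifold (𝓡 4) ∞ M]
  {p : M} {J : ∀ x : punctured p, TangentSpace (𝓡 4) x →L[ℝ] TangentSpace (𝓡 4) x}
  {u L : ℂ → punctured p} {b bL : ℂ}

omit [SecondCountableTopology M] [ChartedSpace (EuclideanSpace ℝ (Fin 4)) M] [IsManifold (𝓡 4) ∞ M] in
/-- The image of a ball under a translate. [folklore] -/
theorem image_comp_add_right_ball (f : ℂ → punctured p) (ξ : ℂ) (ρ : ℝ) :
    (f ∘ fun z : ℂ => z + ξ) '' ball 0 ρ = f '' ball ξ ρ := by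
  rw [image_comp]
  congr 1
  ext z
  simp only [mem_image, mem_ball, dist_zero_right, Complex.dist_eq]
  constructor
  · rintro ⟨w, hw, rfl⟩; simpa using hw
  · intro hz; exact ⟨z - ξ, by simpa using hz, by ring⟩

/-- **McDuff's dichotomy for two members through a common point** (`u ξ = L ζ`): either the
pair of parameters is isolated, or the image germs are nested both ways.
[cite: McDuff1991LocalBehaviour, Lemma 2.7] -/
theorem localDichotomy (hu : IsPencilPlane J u b) (hL : IsPencilPlane J L bL)
    (hJ2 : ∀ (x : punctured p) (v : TangentSpace (𝓡 4) x), J x (J x v) = -v)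
    (hJs : ∀ x₀ : punctured p, ContMDiffAt (𝓡 4)
      𝓘(ℝ, EuclideanSpace ℝ (Fin 4) →L[ℝ] EuclideanSpace ℝ (Fin 4)) ∞
      (inTangentCoordinates (𝓡 4) (𝓡 4) (id : punctured p → punctured p) id (fun x => J x) x₀) x₀)
    {ξ ζ : ℂ} (hξζ : u ξ = L ζ) :
    (∃ ρ : ℝ, 0 < ρ ∧ ∀ s ∈ ball (0 : ℂ) ρ, ∀ t ∈ ball (0 : ℂ) ρ,
        u (s + ξ) = L (t + ζ) → s = 0 ∧ t = 0) ∨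
    (∀ ρ : ℝ, 0 < ρ → ∃ ρ' : ℝ, 0 < ρ' ∧
        u '' ball ξ ρ' ⊆ L '' ball ζ ρ ∧ L '' ball ζ ρ' ⊆ u '' ball ξ ρ) := by
  have h := jHolomorphic_intersectionDichotomy_holds (punctured p) J hJ2 hJs
    (u ∘ fun z : ℂ => z + ξ) (L ∘ fun z : ℂ => z + ζ)
    (contMDiff_comp_add_right hu.contMDiff ξ) (hu.isJHolomorphic.comp_add_right hu.contMDiff ξ)
    (contMDiff_comp_add_right hL.contMDiff ζ) (hL.isJHolomorphic.comp_add_right hL.contMDiff ζ)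
    (by simp [hξζ]) (injective_mfderiv_comp_add_right hL.contMDiff (hL.injective_mfderiv ζ))
    (by
      rw [Filter.frequently_iff]
      intro U hU
      obtain ⟨ε, hε, hεU⟩ := Metric.mem_nhds_iff.1 hU
      refine ⟨(ε / 2 : ℝ), hεU (by simp [abs_of_pos hε]; linarith), fun h0 => ?_⟩
      have h1 := hu.injective h0
      have h2 : ((ε / 2 : ℝ) : ℂ) = 0 := by simpa using h1
      have h3 : (ε / 2 : ℝ) = 0 := by exact_mod_cast h2
      linarith)
  rcases h with ⟨ρ, hρ, hiso⟩ | hnest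
  · exact Or.inl ⟨ρ, hρ, fun s hs t ht hst => hiso s hs t ht hst⟩
  · right
    intro ρ hρ
    obtain ⟨ρ', hρ', h1, h2⟩ := hnest ρ hρ
    rw [image_comp_add_right_ball, image_comp_add_right_ball] at h1 h2
    exact ⟨ρ', hρ', h1, h2⟩

/-- **Accumulating intersections are not isolated**: if `u z ∈ L(ℂ)` for `z ≠ ξ` arbitrarily
close to `ξ`, then `u ξ ∈ L(ℂ)` and the image germs of `u` at `ξ` and of `L` at `L⁻¹ (u ξ)` are
nested both ways; in particular `u z ∈ L(ℂ)` for ALL `z` near `ξ`.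
[cite: McDuff1991LocalBehaviour, Lemma 2.7] -/
theorem nested_of_frequently_mem_range (hu : IsPencilPlane J u b) (hL : IsPencilPlane J L bL)
    (hJ2 : ∀ (x : punctured p) (v : TangentSpace (𝓡 4) x), J x (J x v) = -v)
    (hJs : ∀ x₀ : punctured p, ContMDiffAt (𝓡 4)
      𝓘(ℝ, EuclideanSpace ℝ (Fin 4) →L[ℝ] EuclideanSpace ℝ (Fin 4)) ∞
      (inTangentCoordinates (𝓡 4) (𝓡 4) (id : punctured p → punctured p) id (fun x => J x) x₀) x₀)
    {ξ : ℂ} (hacc : ∃ᶠ z in 𝓝[≠] ξ, u z ∈ range L) :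
    ∃ ζ : ℂ, u ξ = L ζ ∧ ∀ ρ : ℝ, 0 < ρ → ∃ ρ' : ℝ, 0 < ρ' ∧
      u '' ball ξ ρ' ⊆ L '' ball ζ ρ ∧ L '' ball ζ ρ' ⊆ u '' ball ξ ρ := by
  -- `u ξ ∈ L(ℂ)` since `L(ℂ)` is closed
  have hclosed : IsClosed (range L) := hL.isClosedEmbedding.isClosed_range
  have hmem : u ξ ∈ range L :=
    hclosed.mem_of_frequently_of_tendsto hacc
      ((hu.continuous.tendsto ξ).mono_left nhdsWithin_le_nhds)
  obtain ⟨ζ, hζ⟩ := hmem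
  refine ⟨ζ, hζ.symm, ?_⟩
  rcases hu.localDichotomy hL hJ2 hJs hζ.symm with ⟨ρ, hρ, hiso⟩ | hnest
  · -- the isolated alternative contradicts the accumulation
    exfalso
    -- `L⁻¹` is continuous on `L(ℂ)`: parameters of nearby intersections converge to `ζ`
    have hemb := hL.isClosedEmbedding.isEmbedding
    have hev : ∀ᶠ z in 𝓝[≠] ξ, u z ∈ range L → False := by
      have hcont : ContinuousAt u ξ := hu.continuous.continuousAt
      -- points `z` near `ξ` with `u z = L t`: then `t` is near `ζ`
      have hpre : ∀ᶠ y in 𝓝 (L ζ), ∀ t, L t = y → t ∈ ball ζ ρ := by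
        have hcl : IsClosed (L '' (ball ζ ρ)ᶜ) :=
          hL.isClosedEmbedding.isClosedMap _ isOpen_ball.isClosed_compl
        have hnot : L ζ ∉ L '' (ball ζ ρ)ᶜ := by
          rintro ⟨t, ht, hLt⟩
          exact ht (by rw [hL.injective hLt]; exact mem_ball_self hρ)
        filter_upwards [hcl.isOpen_compl.mem_nhds hnot] with y hy t hLt
        by_contra hty
        exact hy ⟨t, hty, hLt⟩
      have h2 : ∀ᶠ z in 𝓝 ξ, ∀ t, L t = u z → t ∈ ball ζ ρ := by
        rw [hζ] at hpre
        exact hcont.eventually hpre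
      have h3 : ∀ᶠ z in 𝓝 ξ, z ∈ ball ξ ρ := ball_mem_nhds ξ hρ
      filter_upwards [nhdsWithin_le_nhds h2, nhdsWithin_le_nhds h3, self_mem_nhdsWithin]
        with z hz2 hz3 hzne ⟨t, ht⟩
      have hs : z - ξ ∈ ball (0 : ℂ) ρ := by simpa [mem_ball, Complex.dist_eq] using hz3
      have htb : t - ζ ∈ ball (0 : ℂ) ρ := by
        have := hz2 t ht
        simpa [mem_ball, Complex.dist_eq] using this
      have := (hiso (z - ξ) hs (t - ζ) htb (by simpa using ht.symm)).1
      exact hzne (sub_eq_zero.1 this)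
    exact (hacc.and_eventually hev).exists.elim fun z hz => hz.2 hz.1
  · exact hnest

/-- **Unique continuation, image form**: a member meeting `L(ℂ)` along parameters accumulating
somewhere lies in `L(ℂ)` entirely. [cite: McDuff1991LocalBehaviour, Lemma 2.7] -/
theorem range_subset_of_frequently_mem_range (hu : IsPencilPlane J u b) (hL : IsPencilPlane J L bL)
    (hJ2 : ∀ (x : punctured p) (v : TangentSpace (𝓡 4) x), J x (J x v) = -v)
    (hJs : ∀ x₀ : punctured p, ContMDiffAt (𝓡 4)
      𝓘(ℝ, EuclideanSpace ℝ (Fin 4) →L[ℝ] EuclideanSpace ℝ (Fin 4)) ∞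
      (inTangentCoordinates (𝓡 4) (𝓡 4) (id : punctured p → punctured p) id (fun x => J x) x₀) x₀)
    {ξ₀ : ℂ} (hacc : ∃ᶠ z in 𝓝[≠] ξ₀, u z ∈ range L) : range u ⊆ range L := by
  -- `Ω` = parameters near which `u` stays in `L(ℂ)`
  set Ω : Set ℂ := {ξ | ∀ᶠ z in 𝓝 ξ, u z ∈ range L} with hΩ
  have hΩopen : IsOpen Ω := by
    rw [isOpen_iff_mem_nhds]
    intro ξ hξ
    exact Filter.Eventually.eventually_nhds hξ
  -- key step: accumulation at `ξ` puts `ξ` in `Ω`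
  have hkey : ∀ ξ : ℂ, (∃ᶠ z in 𝓝[≠] ξ, u z ∈ range L) → ξ ∈ Ω := by
    intro ξ hξ
    obtain ⟨ζ, -, hnest⟩ := hu.nested_of_frequently_mem_range hL hJ2 hJs hξ
    obtain ⟨ρ', hρ', h1, -⟩ := hnest 1 one_pos
    show ∀ᶠ z in 𝓝 ξ, u z ∈ range L
    filter_upwards [ball_mem_nhds ξ hρ'] with z hz
    obtain ⟨t, -, ht⟩ := h1 ⟨z, hz, rfl⟩
    exact ⟨t, ht⟩
  have hΩsub : Ω ⊆ {z | u z ∈ range L} := fun ξ hξ => Filter.Eventually.self_of_nhds hξ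
  have hΩclosed : IsClosed Ω := by
    rw [← closure_subset_iff_isClosed]
    intro ξ hξ
    apply hkey
    have hfreq : ∃ᶠ z in 𝓝[≠] ξ, z ∈ Ω := by
      by_cases hξΩ : ξ ∈ Ω
      · exact Filter.Eventually.frequently
          (mem_nhdsWithin_of_mem_nhds (hΩopen.mem_nhds hξΩ) : ∀ᶠ z in 𝓝[≠] ξ, z ∈ Ω)
      · rw [mem_closure_iff_frequently] at hξ
        rw [frequently_nhdsWithin_iff]
        refine hξ.mono fun z hz => ⟨hz, ?_⟩
        rintro rfl
        exact hξΩ hz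
    exact hfreq.mono fun z hz => hΩsub hz
  have hΩuniv : Ω = univ := IsClopen.eq_univ ⟨hΩclosed, hΩopen⟩ ⟨ξ₀, hkey ξ₀ hacc⟩
  rintro y ⟨ξ, rfl⟩
  exact hΩsub (hΩuniv ▸ mem_univ ξ)

/-- **Unique continuation for pencil members**: a member `u` meeting the image of a member `L`
along parameters accumulating at some point IS `L` (images agree by the two-sided nesting and
connectedness of `ℂ`; then rigidity of the canonical parametrisation,
`IsPencilPlane.eq_of_range_eq`). [cite: Wendl2018, Prop. 2.53 with Thm. 2.49] -/
theorem eq_of_frequently_mem_range (hu : IsPencilPlane J u b) (hL : IsPencilPlane J L bL)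
    (hJ2 : ∀ (x : punctured p) (v : TangentSpace (𝓡 4) x), J x (J x v) = -v)
    (hJs : ∀ x₀ : punctured p, ContMDiffAt (𝓡 4)
      𝓘(ℝ, EuclideanSpace ℝ (Fin 4) →L[ℝ] EuclideanSpace ℝ (Fin 4)) ∞
      (inTangentCoordinates (𝓡 4) (𝓡 4) (id : punctured p → punctured p) id (fun x => J x) x₀) x₀)
    {ξ₀ : ℂ} (hacc : ∃ᶠ z in 𝓝[≠] ξ₀, u z ∈ range L) : u = L := by
  have hsub : range u ⊆ range L := hu.range_subset_of_frequently_mem_range hL hJ2 hJs hacc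
  have hall : ∀ ξ : ℂ, ∃ᶠ z in 𝓝[≠] ξ, u z ∈ range L := fun ξ =>
    (Filter.Eventually.of_forall fun z => hsub ⟨z, rfl⟩).frequently
  -- `S = L⁻¹ (u(ℂ))` is clopen and nonempty
  have hSclosed : IsClosed (L ⁻¹' range u) :=
    hu.isClosedEmbedding.isClosed_range.preimage hL.continuous
  have hSopen : IsOpen (L ⁻¹' range u) := by
    rw [isOpen_iff_mem_nhds]
    rintro ζ ⟨ξ, hξ⟩
    obtain ⟨ζ', hζ', hnest⟩ := hu.nested_of_frequently_mem_range hL hJ2 hJs (hall ξ)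
    have hζζ' : ζ' = ζ := hL.injective (hζ'.symm.trans hξ)
    subst hζζ'
    obtain ⟨ρ', hρ', -, h2⟩ := hnest 1 one_pos
    exact mem_of_superset (ball_mem_nhds _ hρ') fun t ht =>
      image_subset_range _ _ (h2 ⟨t, ht, rfl⟩)
  obtain ⟨ζ₀, hζ₀⟩ := hsub ⟨ξ₀, rfl⟩
  have hSuniv : L ⁻¹' range u = univ :=
    IsClopen.eq_univ ⟨hSclosed, hSopen⟩ ⟨ζ₀, by rw [mem_preimage, hζ₀]; exact ⟨ξ₀, rfl⟩⟩
  have hr : range u = range L := hsub.antisymm (by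
    rintro y ⟨ζ, rfl⟩
    exact (hSuniv ▸ mem_univ ζ : ζ ∈ L ⁻¹' range u))
  exact hu.eq_of_range_eq hL hr

/-- **Two members sharing their far ends coincide**: if `u (η⁻¹) ∈ L(ℂ)` for all small
`η ≠ 0` (the "far coincidence" alternative of `IsPencilPlane.constraintIndex_dichotomy`), then
`u = L`. [cite: Wendl2018, Prop. 2.53 with Thm. 2.49] -/
theorem eq_of_eventually_far_mem_range (hu : IsPencilPlane J u b) (hL : IsPencilPlane J L bL)
    (hJ2 : ∀ (x : punctured p) (v : TangentSpace (𝓡 4) x), J x (J x v) = -v)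
    (hJs : ∀ x₀ : punctured p, ContMDiffAt (𝓡 4)
      𝓘(ℝ, EuclideanSpace ℝ (Fin 4) →L[ℝ] EuclideanSpace ℝ (Fin 4)) ∞
      (inTangentCoordinates (𝓡 4) (𝓡 4) (id : punctured p → punctured p) id (fun x => J x) x₀) x₀)
    (hfar : ∀ᶠ η in 𝓝 (0 : ℂ), η ≠ 0 → u η⁻¹ ∈ range L) : u = L := by
  obtain ⟨δ, hδ, hδP⟩ := Metric.eventually_nhds_iff_ball.1 hfar
  -- accumulate at the parameter `ξ₀ = 2/δ`: every `ξ` with `‖ξ‖ > 1/δ` has `u ξ ∈ L(ℂ)`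
  have hlarge : ∀ ξ : ℂ, δ⁻¹ < ‖ξ‖ → u ξ ∈ range L := fun ξ hξ => by
    have hξ0 : ξ ≠ 0 := by
      rintro rfl
      rw [norm_zero] at hξ
      exact lt_irrefl _ (lt_trans (inv_pos.2 hδ) hξ)
    have h := hδP ξ⁻¹ (by
      rw [mem_ball_zero_iff, norm_inv]
      rwa [inv_lt_comm₀ (norm_pos_iff.2 hξ0) hδ]) (inv_ne_zero hξ0)
    rwa [inv_inv] at h
  set ξ₀ : ℂ := ((2 * δ⁻¹ : ℝ) : ℂ) with hξ₀
  have hξ₀n : ‖ξ₀‖ = 2 * δ⁻¹ := by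
    rw [hξ₀, Complex.norm_real, Real.norm_eq_abs, abs_of_pos (by positivity)]
  refine hu.eq_of_frequently_mem_range hL hJ2 hJs (ξ₀ := ξ₀) ?_
  have hev : ∀ᶠ z in 𝓝[≠] ξ₀, u z ∈ range L := by
    have h1 : ∀ᶠ z in 𝓝 ξ₀, δ⁻¹ < ‖z‖ := by
      have hc : ContinuousAt (fun z : ℂ => ‖z‖) ξ₀ := continuous_norm.continuousAt
      exact hc.eventually (lt_mem_nhds (show δ⁻¹ < ‖ξ₀‖ by rw [hξ₀n]; linarith [inv_pos.2 hδ]))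
    exact nhdsWithin_le_nhds (h1.mono fun z hz => hlarge z hz)
  exact hev.frequently

end IsPencilPlane



end Literature.Geometry.Symplectic
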